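import Summits.AtomisticToContinuum.Crystallization.Theorems.PhononStability.Negative.Mirror

/-!
# Route `ExcessDecayLiouville`: named mirrors of the matching / separation / force-balance predicates

The route's statements (`ExcessDecay`, `HcpLiouville`, `GrainsGlue`, …) share a `let`-telescope of local
predicates.  `Theorems/PhononStability/Negative/Mirror.lean` already names the lattice `Λ₀`, the admissible
cells `Adm₀`, the inner-displacement window `Inner₀`, the site set `Sites₀` and the force-constant form
`Hess₀`.  This file names the remaining three —

* `Near₀ X c r t A ε` : two-way `ε`-matching of `X` with the affine two-lattice `t m + A Λ` on the ball
  `dist · c ≤ r`;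
* `Sep₀ X δ` : `δ`-separation;
* `Equil₀ X` : Lennard-Jones force balance at every point of `X` (`HasSum` form);

— and the unconditional content `ExcessDecayCore δ` of item `ExcessDecay` (stmt-AtomisticToContinuum-9334),
so that `ExcessDecay ↔ (PhononStability → ∀ δ > 0, ExcessDecayCore δ)` holds by `Iff.rfl`
(`excessDecay_iff`), together with the reduced per-separation form `ExcessDecayReducedAt δ` (constant `C ≥ 0`, regime
`C/r² < ε/2`) to which the item is reduced (for `δ ≤ 1`) in `Theorems/ExcessDecayLiouvilleExcessDecay.lean`.
All predicates here carry parameters (route-internal bookkeeping, not literature facts).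
Elementary API: monotonicity of `Near₀`.
Everything here is definitional bookkeeping, `[folklore]`; nothing closes an item.
-/

noncomputable section

namespace Summit.AtomisticToContinuum.Crystallization.Theorems.ExcessDecayLiouville

open scoped BigOperators Topology InnerProductSpace
open Literature.MathematicalPhysics.StatisticalMechanics
open Summit.AtomisticToContinuum.Crystallization.Theses.ExcessDecayLiouville
open Summit.AtomisticToContinuum.Crystallization.Theorems.PhononStabilityNegative

/-- **Two-way `ε`-matching on a ball** (verbatim the route's `let Near`): every point of `X` in the closed
ball `dist · c ≤ r` is within `ε` of a site `t m + A z`, `z ∈ Λ₀`, and every such site in the ball is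
within `ε` of a point of `X`. [folklore] -/
def Near₀ (X : Set (EuclideanSpace ℝ (Fin 3))) (c : (EuclideanSpace ℝ (Fin 3))) (r : ℝ) (t : Fin 2 → (EuclideanSpace ℝ (Fin 3))) (A : (EuclideanSpace ℝ (Fin 3)) →L[ℝ] (EuclideanSpace ℝ (Fin 3))) (ε : ℝ) : Prop :=
  (∀ p ∈ X, dist p c ≤ r → ∃ m : Fin 2, ∃ z ∈ Λ₀, dist p (t m + A z) ≤ ε) ∧
  (∀ m : Fin 2, ∀ z ∈ Λ₀, dist (t m + A z) c ≤ r → ∃ p ∈ X, dist p (t m + A z) ≤ ε)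

/-- **`δ`-separation** of a point set (verbatim the route's `let Sep`). [folklore] -/
def Sep₀ (X : Set (EuclideanSpace ℝ (Fin 3))) (δ : ℝ) : Prop :=
  ∀ p ∈ X, ∀ q ∈ X, p ≠ q → δ ≤ dist p q

/-- **Lennard-Jones force balance** at every point of `X` (verbatim the route's `let Equil`): for each
`p ∈ X` the family `q ↦ V′(|p − q|)·(p − q)/|p − q|` over `q ∈ X ∖ {p}` has sum `0`. [folklore] -/
def Equil₀ (X : Set (EuclideanSpace ℝ (Fin 3))) : Prop :=
  ∀ p ∈ X, HasSum (fun q : {q : (EuclideanSpace ℝ (Fin 3)) // q ∈ X ∧ q ≠ p} =>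
    (deriv lennardJones (dist p q.1) / dist p q.1) • (p - q.1)) 0

/-- **The unconditional content of `ExcessDecay` at separation `δ`**: there are `ε₀ > 0`, `θ ∈ (0,1)`,
`r₀`, `C` such that every finite `δ`-separated force-balanced `X`, two-way `ε`-matched (`0 < ε ≤ ε₀`)
with an admissible datum `(t, A)` (hcp-like inner displacement) on a ball of radius `r ≥ r₀`, is
`(ε/2 + C/r²)`-matched on the `θ r`-ball with a corrected datum `(t', A')`, `‖A' − A‖ ≤ Cε/r`
(verbatim the conclusion of the route's `ExcessDecay` after its stability hypothesis). [folklore] -/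
def ExcessDecayCore (δ : ℝ) : Prop :=
  ∃ ε₀ θ r₀ C : ℝ, 0 < ε₀ ∧ 0 < θ ∧ θ < 1 ∧ ∀ X : Set (EuclideanSpace ℝ (Fin 3)), X.Finite → Sep₀ X δ → Equil₀ X →
    ∀ (c : (EuclideanSpace ℝ (Fin 3))) (t : Fin 2 → (EuclideanSpace ℝ (Fin 3))) (A : (EuclideanSpace ℝ (Fin 3)) →L[ℝ] (EuclideanSpace ℝ (Fin 3))) (r ε : ℝ), Adm₀ A → Inner₀ t A → r₀ ≤ r →
      0 < ε → ε ≤ ε₀ → Near₀ X c r t A ε →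
        ∃ (t' : Fin 2 → (EuclideanSpace ℝ (Fin 3))) (A' : (EuclideanSpace ℝ (Fin 3)) →L[ℝ] (EuclideanSpace ℝ (Fin 3))),
          ‖A' - A‖ ≤ C * ε / r ∧ Near₀ X c (θ * r) t' A' (ε / 2 + C / r ^ 2)

/-- **The reduced form of `ExcessDecay` at separation `δ`** (what is left to prove after the bookkeeping
of `Theorems/ExcessDecayLiouvilleExcessDecay.lean`; a route-internal predicate, NOT a literature fact):
the conclusion of `ExcessDecayCore δ` with a nonnegative constant `C` and only in the regime
`C / r² < ε / 2` (otherwise the uncorrected datum `(t, A)` already works).  It is needed only for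
`δ ≤ 1` (larger separations are vacuous):
`excessDecay_of_reduced : (PhononStability → ∀ δ, 0 < δ → δ ≤ 1 → ExcessDecayReducedAt δ) → ExcessDecay`.
[folklore] -/
def ExcessDecayReducedAt (δ : ℝ) : Prop :=
  ∃ ε₀ θ r₀ C : ℝ, 0 < ε₀ ∧ 0 < θ ∧ θ < 1 ∧ 0 ≤ C ∧
    ∀ X : Set (EuclideanSpace ℝ (Fin 3)), X.Finite → Sep₀ X δ → Equil₀ X →
      ∀ (c : (EuclideanSpace ℝ (Fin 3))) (t : Fin 2 → (EuclideanSpace ℝ (Fin 3))) (A : (EuclideanSpace ℝ (Fin 3)) →L[ℝ] (EuclideanSpace ℝ (Fin 3))) (r ε : ℝ), Adm₀ A → Inner₀ t A → r₀ ≤ r →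
        0 < ε → ε ≤ ε₀ → C / r ^ 2 < ε / 2 → Near₀ X c r t A ε →
          ∃ (t' : Fin 2 → (EuclideanSpace ℝ (Fin 3))) (A' : (EuclideanSpace ℝ (Fin 3)) →L[ℝ] (EuclideanSpace ℝ (Fin 3))),
            ‖A' - A‖ ≤ C * ε / r ∧ Near₀ X c (θ * r) t' A' (ε / 2 + C / r ^ 2)

/-- `ExcessDecay` over the named mirror definitions (definitional unfolding only): the item is the
implication "harmonic stability ⇒ excess decay at every separation". [folklore] -/
theorem excessDecay_iff :
    ExcessDecay ↔ (PhononStability → ∀ δ : ℝ, 0 < δ → ExcessDecayCore δ) :=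
  Iff.rfl

/-- `Near₀` is monotone: shrinking the ball (`r' ≤ r`) and enlarging the tolerance (`ε ≤ ε'`)
preserve the matching. [folklore] -/
theorem Near₀.mono {X : Set (EuclideanSpace ℝ (Fin 3))} {c : (EuclideanSpace ℝ (Fin 3))} {r r' : ℝ} {t : Fin 2 → (EuclideanSpace ℝ (Fin 3))} {A : (EuclideanSpace ℝ (Fin 3)) →L[ℝ] (EuclideanSpace ℝ (Fin 3))} {ε ε' : ℝ}
    (h : Near₀ X c r t A ε) (hr : r' ≤ r) (hε : ε ≤ ε') : Near₀ X c r' t A ε' := by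
  refine ⟨fun p hp hpc => ?_, fun m z hz hzc => ?_⟩
  · obtain ⟨m, z, hz, hd⟩ := h.1 p hp (hpc.trans hr)
    exact ⟨m, z, hz, hd.trans hε⟩
  · obtain ⟨p, hp, hd⟩ := h.2 m z hz (hzc.trans hr)
    exact ⟨p, hp, hd.trans hε⟩

end Summit.AtomisticToContinuum.Crystallization.Theorems.ExcessDecayLiouville

end
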